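import Summits.ValiantsHypothesis.ValiantsHypothesis.Theorems.GrenetZeonDualUnipotentThreeHalvesLongMassSeparatedProducts
import Summits.ValiantsHypothesis.ValiantsHypothesis.Theorems.GrenetZeonDualUnipotentThreeHalvesSlowCoreCoarsen

/-!
# `GrenetZeon.DualUnipotentThreeHalves` (stmt-ValiantsHypothesis-24318), line `slow_core`, stub (c) `SlowCore.LongMassSlowLawInv`:
# SEPARATED PRODUCTS, GENERAL FORM — the deep-mode price test for ARBITRARY pencils containing a connector value

✓ `…LongMassSeparatedProducts` proved the coefficient identity `[s^{k+1}] ((A + sW)^{2k+1})_{r 0, r' k} = ∏_l W_{r l, r' l}` for a CONNECTOR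
`A = Σ_{l<k} E_{r' l, r (l+1)}` and a STRICTLY UPPER TRIANGULAR `W`, and used it on the free triangular pencil (two-sided price `√2·√n·b`,
✓ `…LongMassFreeTriangularPrice` / ✓ `…LongMassFreeTriangularCert`).  Reading the kernel proof shows that triangularity of `W` is used ONLY at
the `k(k+1)/2` entries BELOW THE CHAIN: `W_{r q, r' l} = 0` for `l < q ≤ k`.  This file records the identity and the price test in that generality,
so that the enemy side of (c) (where «a CONTESTED candidate is not a violator until a `RelCert` LOWER bound is proved for it», crit V34 §5) has a
deep-mode instrument that applies to NON-triangularisable pencils: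

* ★ `coeff_pow_apply_of_separated_weak` — the coefficient identity under the weak hypothesis `∀ l < q ≤ k, W (r q) (r' l) = 0`.
* ★★ `prod_linMat_eq_zero_of_ledger` — **GENERAL SEPARATED-PRODUCT TEST.**  Let `N` be ANY affine pencil, `(K, k)` a whole-pencil ledger with
  `2k + 2 ≤ n`, `r 0 < r' 0 < ⋯ < r k < r' k` positions (in the given basis) such that (i) some point value `N(x)` IS the connector of the chain and
  (ii) every direction `lin v`, `v ∈ K`, vanishes at the below-chain entries `(r q, r' l)`, `l < q`.  Then `∏_l (lin v)_{r l, r' l} = 0` for every `v ∈ K`.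
* ★★ `exists_dead_entry_of_ledger` — hence ONE chain entry `(r l, r' l)` is dead on `K`: the linear functional `v ↦ (lin v)_{r l, r' l}`
  (✓ `SlowCore.linFun`) vanishes on `K` (Mathlib `Module.Dual.exists_forall_mem_ne_zero_of_forall_exists`).

USE.  For a candidate violator `V` (linear pencil, values = directions = `V`): every separated chain whose connector lies in `V` and below which `V`
vanishes costs a certificate of order `k` one of the `k + 1` chain functionals on `lin K`; packing such chains prices `V` from BELOW in the deep
mode — the free triangular pencil (✓ `prod_eq_zero_of_ledger`) is the case `V = 𝔫_b`, where every chain qualifies.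
HONEST FRAMING.  Instrument (`--supports stmt-ValiantsHypothesis-24318`); NOT progress on (c) `LongMassSlowLawInv` (RESEARCH — OPEN); closes no
stub; S3, 24318, 8062 (`stub_dualUnipotent`) and `VP ≠ VNP` are NOT proved.  Def-free, no named facts, no sorry.  [folklore]
-/

set_option linter.dupNamespace false
set_option autoImplicit false

noncomputable section

namespace Summit.ValiantsHypothesis.ValiantsHypothesis.Theorems.GrenetZeon.FreeTriangularPrice

open MvPolynomial Matrix
open scoped BigOperators
open Summit.ValiantsHypothesis.ValiantsHypothesis.Cruxes.TwoDimCoefficients.DimTwoCases (AffMat IsAffine)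
open Summit.ValiantsHypothesis.ValiantsHypothesis.Theorems.GrenetZeon.RadicalSplit (lineSubst)
open Summit.ValiantsHypothesis.ValiantsHypothesis.Theorems.GrenetZeon.SlowCore (linEntry Ledger RelCert linFun linFun_apply)
open Summit.ValiantsHypothesis.ValiantsHypothesis.Theorems.GrenetZeon.ResolventFlag (pointMat linMat)
open Summit.ValiantsHypothesis.ValiantsHypothesis.Theorems.GrenetZeon.MonomialWalk (map_lineSubst_eq_pointMat)
open Summit.ValiantsHypothesis.ValiantsHypothesis.Theorems.GrenetZeon.InitialForm.SlowCurve (totalDegree_le_iff_coeff)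

/-! ## §1 The coefficient identity under the weak (below-chain) hypothesis -/

section LineMatrix
variable {m : ℕ}

/-- ★ **SEPARATED PRODUCTS — weak form.**  As ✓ `coeff_pow_apply_of_separated`, but `W` need only vanish at the below-chain entries
`(r q, r' l)`, `l < q ≤ k` (instead of being strictly upper triangular). [folklore: unique weighted path] -/
theorem coeff_pow_apply_of_separated_weak (A W : Matrix (Fin m) (Fin m) ℂ) (k : ℕ) (r r' : ℕ → Fin m)
    (hrr' : ∀ l, l ≤ k → r l < r' l) (hsep : ∀ l, l < k → r' l < r (l + 1))
    (hW : ∀ q l : ℕ, l < q → q ≤ k → W (r q) (r' l) = 0)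
    (hA1 : ∀ l, l < k → A (r' l) (r (l + 1)) = 1)
    (hA0 : ∀ α β : Fin m, (∀ l, l < k → α = r' l → β ≠ r (l + 1)) → A α β = 0) :
    coeff (Finsupp.single 0 (k + 1))
      (((A.map (C : ℂ →+* MvPolynomial (Fin 1) ℂ) + (X 0 : MvPolynomial (Fin 1) ℂ) • W.map (C : ℂ →+* MvPolynomial (Fin 1) ℂ))
        ^ (2 * k + 1)) (r 0) (r' k)) = ∏ l ∈ Finset.range (k + 1), W (r l) (r' l) := by
  classical
  set M : Matrix (Fin m) (Fin m) (MvPolynomial (Fin 1) ℂ) :=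
    A.map (C : ℂ →+* MvPolynomial (Fin 1) ℂ) + (X 0 : MvPolynomial (Fin 1) ℂ) • W.map (C : ℂ →+* MvPolynomial (Fin 1) ℂ) with hM
  -- monotonicity of the interleaved positions
  have hmono : ∀ l l', l < l' → l' ≤ k → r' l < r l' := by
    intro l l' hll' hl'
    induction l' with
    | zero => exact absurd hll' (Nat.not_lt_zero _)
    | succ l' ih =>
      rcases Nat.lt_succ_iff_lt_or_eq.1 hll' with h | h
      · exact lt_trans (ih h (by omega)) (lt_trans (hrr' l' (by omega)) (hsep l' (by omega)))
      · subst h; exact hsep l (by omega)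
  have hrr'2 : ∀ l l', l ≤ l' → l' ≤ k → r l < r' l' := by
    intro l l' hll' hl'
    rcases Nat.lt_or_eq_of_le hll' with h | h
    · exact lt_trans (hrr' l (by omega)) (lt_trans (hmono l l' h hl') (hrr' l' hl'))
    · subst h; exact hrr' l hl'
  -- rows of `A` are the `r' l`, `l < k`; every other row vanishes
  have hrow : ∀ α : Fin m, (∀ l, l < k → α ≠ r' l) → ∀ β, A α β = 0 :=
    fun α hα β => hA0 α β fun l hl hαl => absurd hαl (hα l hl)
  have hrow_r : ∀ l, l ≤ k → ∀ β, A (r l) β = 0 := by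
    intro l hl β
    refine hrow _ (fun l' hl' h => ?_) β
    rcases lt_or_ge l' l with h' | h'
    · exact absurd h (ne_of_gt (hmono l' l h' hl))
    · exact absurd h (ne_of_lt (hrr'2 l l' h' (by omega)))
  have hrowr' : ∀ l, l < k → ∀ β, β ≠ r (l + 1) → A (r' l) β = 0 := by
    intro l hl β hβ
    refine hA0 _ _ fun l' hl' h => ?_
    have : l = l' := by
      by_contra hne
      rcases lt_or_gt_of_ne hne with h' | h'
      · exact absurd h (ne_of_lt (lt_trans (hmono l l' h' (by omega)) (hrr' l' (by omega))))
      · exact absurd h (ne_of_gt (lt_trans (hmono l' l h' (by omega)) (hrr' l (by omega))))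
    subst this; exact hβ
  -- the vectors `u_j = M^{2j} e_{r' k}` and their coefficient arrays
  set e : Fin m → MvPolynomial (Fin 1) ℂ := Pi.single (r' k) 1 with he
  have INV : ∀ j, j ≤ k →
      (∀ α, ∀ d, d < j → coeff (Finsupp.single 0 d) (((M ^ (2 * j)) *ᵥ e) α) = 0) ∧
      (∀ α, (∀ m', m' ≤ k - j → α ≠ r' m') → coeff (Finsupp.single 0 j) (((M ^ (2 * j)) *ᵥ e) α) = 0) ∧
      coeff (Finsupp.single 0 j) (((M ^ (2 * j)) *ᵥ e) (r' (k - j))) = ∏ l ∈ Finset.Ico (k - j + 1) (k + 1), W (r l) (r' l) := by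
    intro j
    induction j with
    | zero =>
      intro _
      refine ⟨fun α d hd => absurd hd (Nat.not_lt_zero _), fun α hα => ?_, ?_⟩
      · rw [Nat.mul_zero, pow_zero, Matrix.one_mulVec, he, Pi.single_apply, if_neg (hα k (by omega)), MvPolynomial.coeff_zero]
      · rw [Nat.mul_zero, pow_zero, Matrix.one_mulVec, he, Nat.sub_zero, Pi.single_eq_same, Finset.Ico_self,
          Finset.prod_empty, Finsupp.single_zero]
        exact MvPolynomial.coeff_zero_one
    | succ j ih =>
      intro hj
      obtain ⟨h1, h2, h3⟩ := ih (by omega)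
      set u := (M ^ (2 * j)) *ᵥ e with hu
      set w := M *ᵥ u with hw
      have hu' : (M ^ (2 * (j + 1))) *ᵥ e = M *ᵥ w := by
        rw [hw, hu, Matrix.mulVec_mulVec, Matrix.mulVec_mulVec,
          show 2 * (j + 1) = 2 * j + 1 + 1 by ring, pow_succ', pow_succ', Matrix.mul_assoc]
      -- `w ≡ 0 mod s^{j+1}`
      have hw0 : ∀ β, ∀ d, d ≤ j → coeff (Finsupp.single 0 d) (w β) = 0 := by
        intro β d hd
        rcases d with _ | d
        · rw [hw, hM, coeff_zero_mulVec_apply]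
          refine Finset.sum_eq_zero fun γ _ => ?_
          rcases Nat.eq_zero_or_pos j with hj0 | hj0
          · -- `j = 0`: `u = e`, and the column `r' k` of `A` vanishes
            by_cases hγ : γ = r' k
            · subst hγ
              by_cases hβ : ∃ l, l < k ∧ β = r' l
              · obtain ⟨l, hl, rfl⟩ := hβ
                rw [hrowr' l hl _ (ne_of_gt (hrr'2 (l + 1) k (by omega) le_rfl)), zero_mul]
              · push Not at hβ
                rw [hrow β (fun l hl h => hβ l hl h) _, zero_mul]
            · rw [hu, hj0, Nat.mul_zero, pow_zero, Matrix.one_mulVec, he, Pi.single_apply, if_neg hγ,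
                MvPolynomial.coeff_zero, mul_zero]
          · rw [h1 γ 0 hj0, mul_zero]
        · rw [hw, hM, coeff_succ_mulVec_apply]
          refine Finset.sum_eq_zero fun γ _ => ?_
          have hd' : coeff (Finsupp.single 0 d) (u γ) = 0 := h1 γ d (by omega)
          rw [hd', mul_zero, add_zero]
          rcases Nat.lt_or_ge (d + 1) j with hlt | hge
          · rw [h1 γ (d + 1) hlt, mul_zero]
          · have hdj : d + 1 = j := by omega
            rw [hdj]
            -- degree `j`: `A β γ ≠ 0` forces `γ = r (l+1)`, where `u` has no `s^j`
            by_cases hβ : ∃ l, l < k ∧ β = r' l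
            · obtain ⟨l, hl, rfl⟩ := hβ
              by_cases hγ : γ = r (l + 1)
              · subst hγ
                rw [h2 _ (fun m' hm' h => ?_), mul_zero]
                rcases Nat.lt_or_ge m' (l + 1) with h' | h'
                · exact absurd h (ne_of_gt (hmono m' (l + 1) h' (by omega)))
                · exact absurd h (ne_of_lt (hrr'2 (l + 1) m' h' (by omega)))
              · rw [hrowr' l hl γ hγ, zero_mul]
            · push Not at hβ
              rw [hrow β (fun l hl h => hβ l hl h) γ, zero_mul]
      refine ⟨?_, ?_, ?_⟩
      · -- (i) no degrees `< j + 1`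
        intro α d hd
        rw [hu']
        rcases d with _ | d
        · rw [hM, coeff_zero_mulVec_apply]
          exact Finset.sum_eq_zero fun γ _ => by rw [hw0 γ 0 (by omega), mul_zero]
        · rw [hM, coeff_succ_mulVec_apply]
          exact Finset.sum_eq_zero fun γ _ => by
            rw [hw0 γ (d + 1) (by omega), hw0 γ d (by omega), mul_zero, mul_zero, add_zero]
      · -- (ii) degree `j + 1` lives on the rows `r' m'`, `m' ≤ k - (j+1)`
        intro α hα
        rw [hu', hM, coeff_succ_mulVec_apply]
        refine Finset.sum_eq_zero fun γ _ => ?_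
        rw [hw0 γ j le_rfl, mul_zero, add_zero]
        by_cases hαr : ∃ l, l < k ∧ α = r' l
        · obtain ⟨l, hl, rfl⟩ := hαr
          by_cases hγ : γ = r (l + 1)
          · subst hγ
            -- `l > k - (j+1)`: then `coeff_{j+1} (w (r (l+1))) = Σ_β W (r(l+1)) β coeff_j (u β) = 0`
            have hl' : k - (j + 1) < l := by
              by_contra hcon
              exact hα l (by omega) rfl
            rw [hw, hM, coeff_succ_mulVec_apply, Finset.sum_eq_zero, mul_zero]
            intro β _
            rw [hrow_r (l + 1) (by omega) β, zero_mul, zero_add]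
            by_cases hβ : ∃ m', m' ≤ k - j ∧ β = r' m'
            · obtain ⟨m', hm', rfl⟩ := hβ
              rw [hW (l + 1) m' (by omega) (by omega), zero_mul]
            · push Not at hβ
              rw [h2 β (fun m' hm' h => hβ m' hm' h), mul_zero]
          · rw [hrowr' l hl γ hγ, zero_mul]
        · push Not at hαr
          rw [hrow α (fun l hl h => hαr l hl h) γ, zero_mul]
      · -- (iii) the main coefficient
        have hl0 : k - (j + 1) < k := by omega
        have hkj : k - (j + 1) + 1 = k - j := by omega
        have hA1' : A (r' (k - (j + 1))) (r (k - j)) = 1 := by rw [← hkj]; exact hA1 _ hl0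
        rw [hu', hM, coeff_succ_mulVec_apply, Finset.sum_eq_single (r (k - j))]
        · rw [hw0 _ j le_rfl, mul_zero, add_zero, hA1', one_mul, hw, hM, coeff_succ_mulVec_apply,
            Finset.sum_eq_single (r' (k - j))]
          · rw [hrow_r (k - j) (by omega), zero_mul, zero_add, h3, hkj,
              Finset.prod_eq_prod_Ico_succ_bot (show k - j < k + 1 by omega)]
          · intro β _ hβ
            rw [hrow_r (k - j) (by omega), zero_mul, zero_add]
            by_cases hβ' : ∃ m', m' ≤ k - j ∧ β = r' m'
            · obtain ⟨m', hm', rfl⟩ := hβ'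
              have hm'' : m' < k - j := lt_of_le_of_ne hm' (fun h => hβ (by rw [h]))
              rw [hW (k - j) m' hm'' (by omega), zero_mul]
            · push Not at hβ'
              rw [h2 β (fun m' hm' h => hβ' m' hm' h), mul_zero]
          · intro h; exact absurd (Finset.mem_univ _) h
        · intro β _ hβ
          rw [hw0 β j le_rfl, mul_zero, add_zero, hrowr' _ hl0 β (by rwa [hkj]), zero_mul]
        · intro h; exact absurd (Finset.mem_univ _) h
  -- read off the entry `(r 0, r' k)` of `M^{2k+1} = M · M^{2k}`
  obtain ⟨-, h2, h3⟩ := INV k le_rfl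
  rw [Nat.sub_self] at h2 h3
  have hentry : (M ^ (2 * k + 1)) (r 0) (r' k) = ((M ^ (2 * k + 1)) *ᵥ e) (r 0) := by
    rw [he, Matrix.mulVec_single_one]; rfl
  rw [hentry, pow_succ', ← Matrix.mulVec_mulVec, hM, coeff_succ_mulVec_apply, Finset.sum_eq_single (r' 0)]
  · rw [hrow_r 0 (by omega), zero_mul, zero_add, h3, Nat.zero_add, Finset.range_eq_Ico,
      Finset.prod_eq_prod_Ico_succ_bot (show 0 < k + 1 by omega)]
  · intro β _ hβ
    rw [hrow_r 0 (by omega), zero_mul, zero_add, h2 β (fun m' hm' h => hβ ?_), mul_zero]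
    rw [h, Nat.le_zero.mp hm']
  · intro h; exact absurd (Finset.mem_univ _) h

end LineMatrix

/-! ## §2 The price test for an arbitrary affine pencil -/

section AnyPencil
variable {n b : ℕ}

/-- ★★ **GENERAL SEPARATED-PRODUCT TEST.**  `N` any affine pencil; `(K, k)` a whole-pencil ledger, window `2k + 2 ≤ n`; a separated chain
`r 0 < r' 0 < ⋯ < r k < r' k` whose CONNECTOR is a point value `N(x)` and below which every direction of `K` vanishes.  Then the product of the
chain entries of every direction vanishes. -/
theorem prod_linMat_eq_zero_of_ledger (N : AffMat n b) (hN : IsAffine N)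
    {K : Submodule ℂ (Fin n × Fin n → ℂ)} {k : ℕ} (hK : Ledger n b N (fun _ => True) K k) (hk : 2 * k + 2 ≤ n)
    (r r' : ℕ → Fin b) (hrr' : ∀ l, l ≤ k → r l < r' l) (hsep : ∀ l, l < k → r' l < r (l + 1))
    (x : Fin n × Fin n → ℂ) (hA1 : ∀ l, l < k → pointMat N x (r' l) (r (l + 1)) = 1)
    (hA0 : ∀ α β : Fin b, (∀ l, l < k → α = r' l → β ≠ r (l + 1)) → pointMat N x α β = 0)
    (hW : ∀ v ∈ K, ∀ q l : ℕ, l < q → q ≤ k → linMat N v (r q) (r' l) = 0)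
    {v : Fin n × Fin n → ℂ} (hv : v ∈ K) :
    ∏ l ∈ Finset.range (k + 1), linMat N v (r l) (r' l) = 0 := by
  have hdeg := hK x v hv (2 * k + 1) (by omega) (r 0) (r' k) trivial trivial
  rw [map_lineSubst_eq_pointMat N hN x v] at hdeg
  have hcoef := (totalDegree_le_iff_coeff _ k).1 hdeg (k + 1) (Nat.lt_succ_self k)
  rwa [coeff_pow_apply_of_separated_weak (pointMat N x) (linMat N v) k r r' hrr' hsep (hW v hv) hA1 hA0] at hcoef

/-- ★★ **A DEAD CHAIN ENTRY.**  Under the hypotheses of `prod_linMat_eq_zero_of_ledger`, one of the `k + 1` chain functionals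
`v ↦ (lin v)_{r l, r' l}` vanishes identically on `K`. -/
theorem exists_dead_entry_of_ledger (N : AffMat n b) (hN : IsAffine N)
    {K : Submodule ℂ (Fin n × Fin n → ℂ)} {k : ℕ} (hK : Ledger n b N (fun _ => True) K k) (hk : 2 * k + 2 ≤ n)
    (r r' : ℕ → Fin b) (hrr' : ∀ l, l ≤ k → r l < r' l) (hsep : ∀ l, l < k → r' l < r (l + 1))
    (x : Fin n × Fin n → ℂ) (hA1 : ∀ l, l < k → pointMat N x (r' l) (r (l + 1)) = 1)
    (hA0 : ∀ α β : Fin b, (∀ l, l < k → α = r' l → β ≠ r (l + 1)) → pointMat N x α β = 0)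
    (hW : ∀ v ∈ K, ∀ q l : ℕ, l < q → q ≤ k → linMat N v (r q) (r' l) = 0) :
    ∃ l, l ≤ k ∧ ∀ v ∈ K, linMat N v (r l) (r' l) = 0 := by
  by_contra hcon
  push Not at hcon
  have hlin : ∀ v (i j : Fin b), linMat N v i j = linFun N i j v := fun v i j => by
    rw [linFun_apply]; rfl
  obtain ⟨v, hv, hne⟩ := Module.Dual.exists_forall_mem_ne_zero_of_forall_exists K
    (fun l : Fin (k + 1) => (linFun N (r l) (r' l) : Module.Dual ℂ (Fin n × Fin n → ℂ)))
    (fun l => by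
      obtain ⟨v, hv, hne⟩ := hcon l (Nat.lt_succ_iff.mp l.2)
      exact ⟨v, hv, by rwa [← hlin]⟩)
  have h0 := prod_linMat_eq_zero_of_ledger N hN hK hk r r' hrr' hsep x hA1 hA0 hW hv
  rw [Finset.prod_eq_zero_iff] at h0
  obtain ⟨l, hl, h0⟩ := h0
  exact hne ⟨l, Finset.mem_range.mp hl⟩ (by rwa [← hlin])

end AnyPencil

end Summit.ValiantsHypothesis.ValiantsHypothesis.Theorems.GrenetZeon.FreeTriangularPrice

end
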